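import Literature.MathematicalPhysics.QuantumLattice.TorusSectorGibbsParticleHole
import HarnessLib

/-!
# Torus limits of `N`-particle families under the particle–hole transformation, and the one-body dictionary of
# `ω ∘ α`

Family `hubbard` (topic `MathematicalPhysics/QuantumLattice`); seat `hubbard-downfold-unc-2` (cell `pub/hubbard-downfold`,
row «FILLING direction of BOX → WORD»: the electron-doped half `n > 1`, now at `T = 0`). Sequel of
`InfVolFermionStateParticleHole` (the staggered particle–hole automorphism `α` of the quasi-local CAR algebra, `α_Λ(A) = P_Λ A P_Λᴴ`,
and the state `ω ∘ α = ω.particleHole`) and of `TorusSectorGibbsParticleHole` (its `T > 0` use: canonical Gibbs MIXTURES,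
which are translation invariant, so that the torus average could be dropped). Here the VECTOR-level statement needed at
`T = 0` (single, possibly non-invariant torus vectors — degenerate ground states):

* §1 (any finite orbital set) relabellings intertwine the particle–hole automorphisms whose signs correspond,
  `Γ_e ∘ α_ε = α_{ε∘e⁻¹} ∘ Γ_e` (`relabel_particleHoleAut`); a global sign costs at most one `Θ` (`particleHoleAut_units_mul`);
  `⟨ψ, α_ε(b) ψ⟩ = ⟨P_εᴴψ, b P_εᴴψ⟩` (`expect_particleHoleAut`).
* §2 (even tori `(ℤ/Lℤ)²`) the stagger is multiplicative (`torusStagger_add`), a translation `τ_w` changes the signs of `α` by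
  the GLOBAL factor `ε_{ι(-w)} = ±1` (`relabel_translate_particleHoleAut`), hence — the odd case being one `Θ`, invisible in an
  `N`-particle vector — term by term `⟨U_w ψ, α(B) U_w ψ⟩ = ⟨U_w P_Lᴴψ, B U_w P_Lᴴψ⟩` (`expect_particleHoleAut_fockTranslate_mulVec`)
  and **`torusAvgExpect L Λ (α_Λ A) ψ = torusAvgExpect L Λ A (P_Lᴴ ψ)`** for every `N`-particle torus vector `ψ`, every region
  `Λ ⊆ ℤ²` and every `A ∈ 𝔄_Λ` (`torusAvgExpectAt_phAut_eq`, `torusAvgExpect_phAut_eq`).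
* §3 **`IsTorusLimitOf.particleHole`**: if `ω` is the torus limit of `N_j`-particle vectors `ψ (Ls j)` along `Ls` with `Ls j`
  eventually even, then `ω ∘ α` is the torus limit of `L ↦ P_Lᴴ ψ_L` along `Ls` (plus `IsTorusLimitOf.comp_tendsto`,
  `IsTorusLimitOf.congr_family`).
* §4 the ONE-BODY DICTIONARY of `ω ∘ α` (any dimension, any state, any region): for distinct orbitals
  `(ω ∘ α)(c†_{xσ} c_{yτ}) = -ε_x ε_y ω(c†_{yτ} c_{xσ})`; on sublattice-joining bonds (`ε_y = -ε_x`, nearest neighbours) the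
  hopping word is transposed and the symmetric kinetic bond word is INVARIANT; inside a sublattice (`ε_y = ε_x`, diagonal bonds)
  it changes sign (`t' ↦ -t'`) — the words by which kinetic-energy / diagonal-hopping leaves are read through `α`.

The ground-state half (sector ground states of `H_L(t,t',U)` ↦ sector ground states of `H_L(t,-t',U)`, the record `T = 0` class
and its dictionary) is the sequel `TorusGroundStateParticleHole`. Everything is PROVED; no definition, no named fact, no sorry.
HONEST LIMITS: two dimensions and even tori for §2–§3 (odd tori are not bipartite); no number.

## References
* H. Tasaki, *Physics and Mathematics of Quantum Many-Body Systems* (2020), §9.3.3 (the particle–hole / Shiba map).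
  [cite: Tasaki2020, §9.3.3]
* E. H. Lieb, PRL 62 (1989) 1201, proof of Theorem 2 (staggered particle–hole unitary on a bipartite lattice).
  [cite: LiebPRL1989, Theorem 2 (bipartite lattice)]
* F. H. L. Essler et al., *The One-Dimensional Hubbard Model* (2005), §2.2.4 eqs. (2.59)–(2.61). [cite: EsslerEtAl2005, §2.2.4 eqs. (2.59)–(2.61)]
* H. Araki, H. Moriya, Rev. Math. Phys. 15 (2003) 93, §4.1 Def. 4.2–4.5 (`Θ`, translations, even states).
  [cite: ArakiMoriya2003, §4.1]
* O. Bratteli, D. W. Robinson, *OAQSM I* (1987) §4.3.1 (group averages, weak-⋆ limits); *OAQSM II* (1997) §5.2.2 Thm. 5.2.5.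
  [cite: BratteliRobinsonI1987, §4.3.1 (PDF pp. 373–375)] [cite: BratteliRobinsonII1997, §5.2.2 Thm. 5.2.5]

## Mathlib / tree search
REUSED: `particleHoleAut(_apply/_annihilation/_creation/_neg)`, `phAut`, `siteStagger(_eq_one_or)`, `phAut_cAt(_conjTranspose)`,
`InfVolFermionState.particleHole(_expect)` (`InfVolFermionStateParticleHole`); `fermionEmbed_toTorusEmb_phAut`
(`TorusSectorGibbsParticleHole`); `algHom_ext_car`, `expect_parityAut_of_isNParticle`, `torusAvgExpectAt_of_injOn/_of_not_injOn`,
`torusAvgExpect_eq/_zero`, `IsTorusLimitOf` (`InfVolFermionState`); `relabel(_annihilation/_creation)`, `relabel_eq_fockRelabel_conj`,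
`Orb.translate(_orb/_neg)`, `fockTranslate_val_conjTranspose` (`FermionRelabelling`, `FockRelabel`, `HubbardTorusLocalCertificate`);
`torusStagger(_apply)`, `FermionTorus.ofTorusSite/toTorusSite` (`HubbardModel`); `annihilation_mul_creation_add_creation_mul_annihilation_holds`.
The multiplicativity of the torus stagger existed only as private lemmas (`HubbardPseudospinIsotropy`, `HubbardOneBodyDensityMatrix`);
`lean search 'relabel.*particleHoleAut|IsTorusLimitOf.particleHole'`: nothing before this file.
-/

noncomputable section

namespace Literature.MathematicalPhysics.QuantumLattice

open Matrix Finset HubbardWave0 Literature.Probability.LatticeModels ThermodynamicLimit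
open _root_.Filter
open scoped _root_.Topology ComplexOrder BigOperators

/-! ### §1 Any finite orbital set: relabellings versus the particle–hole automorphism; `⟨ψ, α(b) ψ⟩ = ⟨Pᴴψ, b Pᴴψ⟩` -/

section Local

variable {ι ι' : Type*} [LinearOrder ι] [Fintype ι] [LinearOrder ι'] [Fintype ι']

/-- **Relabellings intertwine the particle–hole automorphisms whose signs correspond**:
`Γ_e ∘ α_ε = α_{ε ∘ e⁻¹} ∘ Γ_e` for every orbital bijection `e` (both composites are the algebra homomorphisms
`c_i ↦ ε_i c†_{e i}`; uniqueness on the CAR generators, `algHom_ext_car`).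
[cite: BratteliRobinsonII1997, §5.2.2 Thm. 5.2.5] -/
theorem relabel_particleHoleAut (e : ι ≃ ι') (ε : ι → ℤˣ) (b : Matrix (Finset ι) (Finset ι) ℂ) :
    relabel e (particleHoleAut ε b) = particleHoleAut (fun i' => ε (e.symm i')) (relabel e b) := by
  have h : ((relabel e).toAlgHom).comp (particleHoleAut ε) =
      (particleHoleAut (fun i' => ε (e.symm i'))).comp ((relabel e).toAlgHom) := by
    refine algHom_ext_car (fun i => ?_) (fun i => ?_)
    · rw [AlgHom.comp_apply, AlgHom.comp_apply, AlgEquiv.toAlgHom_apply, AlgEquiv.toAlgHom_apply,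
        particleHoleAut_annihilation, map_smul, relabel_creation, relabel_annihilation,
        particleHoleAut_annihilation, Equiv.symm_apply_apply]
    · rw [AlgHom.comp_apply, AlgHom.comp_apply, AlgEquiv.toAlgHom_apply, AlgEquiv.toAlgHom_apply,
        particleHoleAut_creation, map_smul, relabel_annihilation, relabel_creation,
        particleHoleAut_creation, Equiv.symm_apply_apply]
  have := congrArg (fun f : Matrix (Finset ι) (Finset ι) ℂ →ₐ[ℂ] Matrix (Finset ι') (Finset ι') ℂ => f b) h
  simpa only [AlgHom.comp_apply, AlgEquiv.toAlgHom_apply] using this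

/-- A global sign is invisible or costs one `Θ`: `α_{s·ε} = α_ε` for `s = 1` and `α_{s·ε} = Θ ∘ α_ε` for `s = -1`
(`particleHoleAut_neg`). [cite: ArakiMoriya2003, §4.1 Def. 4.2] -/
theorem particleHoleAut_units_mul (s : ℤˣ) (ε : ι → ℤˣ) (b : Matrix (Finset ι) (Finset ι) ℂ) :
    particleHoleAut (fun i => s * ε i) b =
      if s = 1 then particleHoleAut ε b else parityAut (particleHoleAut ε b) := by
  rcases Int.units_eq_one_or s with rfl | rfl
  · rw [if_pos rfl]
    simp only [one_mul]
  · have hfun : (fun i => (-1 : ℤˣ) * ε i) = -ε := funext fun i => by rw [Pi.neg_apply, neg_one_mul]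
    rw [if_neg (by decide), hfun, particleHoleAut_neg]

/-- **`⟨ψ, α_ε(b) ψ⟩ = ⟨P_εᴴ ψ, b P_εᴴ ψ⟩`**: the expectation of the particle–hole image of `b` in `ψ` is the
expectation of `b` in the transformed vector `P_εᴴ ψ`. [cite: Tasaki2020, §9.3.3] -/
theorem expect_particleHoleAut (ε : ι → ℤˣ) (b : Matrix (Finset ι) (Finset ι) ℂ) (ψ : Fock ι) :
    expect (particleHoleAut ε b) ψ =
      expect b ((particleHole (fun i => (((ε i : ℤˣ) : ℤ) : ℂ)))ᴴ *ᵥ ψ) := by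
  rw [particleHoleAut_apply, expect, expect, star_mulVec, conjTranspose_conjTranspose, ← dotProduct_mulVec,
    mulVec_mulVec, mulVec_mulVec]

end Local

/-! ### §2 Even tori: translations versus `α`, and the translation-averaged expectations of `α_Λ(A)` -/

section Torus

variable {L : ℕ}

/-- `|(ℤ/Lℤ)²| = L²` (in this file's instance context). [folklore] -/
private theorem card_fermionTorus_two' (L : ℕ) : Fintype.card (FermionTorus 2 L) = L ^ 2 := by
  simp [FermionTorus, Fintype.card_lex]

/-- The particle–hole phases of the torus are unimodular. [folklore] -/
private theorem norm_torusPhase (i : Orb (FermionTorus 2 L)) : ‖((torusStagger (ofLex i).1 : ℤ) : ℂ)‖ = 1 :=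
  norm_intCast_units _

/-- `ε_x ε_{x+r} = ε_r` on a torus of even side (reduction mod the even `L` does not change parities).
[cite: LiebPRL1989, Theorem 2 (bipartite lattice)] -/
private theorem torusStagger_mul_torusStagger_add (hL : Even L) (x r : FermionTorus 2 L) :
    torusStagger x * torusStagger (x + r) = torusStagger r := by
  have h2 : (2 : ℕ) ∣ L := even_iff_two_dvd.mp hL
  have hmod : (∑ i, (ofLex (x + r) i : ℕ)) % 2 = (∑ i, (ofLex x i : ℕ) + ∑ i, (ofLex r i : ℕ)) % 2 := by
    calc (∑ i, (ofLex (x + r) i : ℕ)) % 2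
        = (∑ i, ((ofLex x i : ℕ) + (ofLex r i : ℕ)) % L) % 2 :=
          congrArg (· % 2) (Finset.sum_congr rfl fun i _ => Fin.val_add _ _)
      _ = (∑ i, ((ofLex x i : ℕ) + (ofLex r i : ℕ)) % L % 2) % 2 := Finset.sum_nat_mod _ _ _
      _ = (∑ i, ((ofLex x i : ℕ) + (ofLex r i : ℕ)) % 2) % 2 :=
          congrArg (· % 2) (Finset.sum_congr rfl fun i _ => Nat.mod_mod_of_dvd _ h2)
      _ = (∑ i, ((ofLex x i : ℕ) + (ofLex r i : ℕ))) % 2 := (Finset.sum_nat_mod _ _ _).symm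
      _ = (∑ i, (ofLex x i : ℕ) + ∑ i, (ofLex r i : ℕ)) % 2 := by rw [Finset.sum_add_distrib]
  have hkey : (∑ i, (ofLex x i : ℕ) + ∑ i, (ofLex (x + r) i : ℕ)) % 2 = (∑ i, (ofLex r i : ℕ)) % 2 := by
    omega
  have hpow : ∀ (u : ℤˣ) (n : ℕ), u ^ n = u ^ (n % 2) := fun u n => Int.units_pow_eq_pow_mod_two u n
  rw [torusStagger_apply, torusStagger_apply, torusStagger_apply, ← uzpow_add, hpow, hkey, ← hpow]

/-- **The stagger is multiplicative on the even torus**: `ε_{x+r} = ε_x ε_r`. [cite: LiebPRL1989, Theorem 2 (bipartite lattice)] -/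
theorem torusStagger_add (hL : Even L) (x r : FermionTorus 2 L) :
    torusStagger (x + r) = torusStagger x * torusStagger r := by
  rw [← torusStagger_mul_torusStagger_add hL x r, ← mul_assoc, Int.units_mul_self, one_mul]

/-- `toTorusSite` is additive. [folklore] -/
private theorem toTorusSite_add' (x v : FermionTorus 2 L) :
    FermionTorus.toTorusSite (x + v) = FermionTorus.toTorusSite x + FermionTorus.toTorusSite v := by
  funext i
  simp only [FermionTorus.toTorusSite_apply, Pi.add_apply]
  rw [show ofLex (x + v) i = ofLex x i + ofLex v i from rfl, Fin.val_add, ZMod.natCast_mod, Nat.cast_add]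

/-- The inverse translation acts on native orbitals as `(x, σ) ↦ (x + ι(-w), σ)`. [cite: FriedliVelenik2017, §3.1] -/
theorem translate_symm_orb [NeZero L] (w : TorusSite 2 L) (x : FermionTorus 2 L) (σ : Fin 2) :
    (Orb.translate w).symm (orb x σ) = orb (x + FermionTorus.ofTorusSite (-w)) σ := by
  rw [← Equiv.Perm.inv_def, ← Orb.translate_neg]
  conv_lhs => rw [← FermionTorus.ofTorusSite_toTorusSite x]
  rw [Orb.translate_orb, ← FermionTorus.toTorusSite_ofTorusSite (-w), ← toTorusSite_add',
    FermionTorus.ofTorusSite_toTorusSite, FermionTorus.toTorusSite_ofTorusSite]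

/-- **The torus signs after an inverse translation**: `ε_{τ_w⁻¹ i} = ε_{ι(-w)} · ε_i` (`L` even).
[cite: LiebPRL1989, Theorem 2 (bipartite lattice)] -/
theorem torusStagger_translate_symm [NeZero L] (hL : Even L) (w : TorusSite 2 L) (i : Orb (FermionTorus 2 L)) :
    torusStagger (ofLex ((Orb.translate w).symm i)).1 =
      torusStagger (FermionTorus.ofTorusSite (-w)) * torusStagger (ofLex i).1 := by
  have hi : i = orb (ofLex i).1 (ofLex i).2 := rfl
  conv_lhs => rw [hi, translate_symm_orb]
  rw [show (ofLex (orb ((ofLex i).1 + FermionTorus.ofTorusSite (-w)) (ofLex i).2)).1 =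
      (ofLex i).1 + FermionTorus.ofTorusSite (-w) from rfl, torusStagger_add hL, mul_comm]

/-- **Translations versus the staggered particle–hole automorphism of the even torus**:
`Γ(τ_w) (α X) = α_{s·ε} (Γ(τ_w) X)` with the global sign `s = ε_{ι(-w)}` (`= ±1` according to the parity of the
translation). [cite: ArakiMoriya2003, §4.1 Def. 4.3] -/
theorem relabel_translate_particleHoleAut [NeZero L] (hL : Even L) (w : TorusSite 2 L)
    (X : Matrix (Finset (Orb (FermionTorus 2 L))) (Finset (Orb (FermionTorus 2 L))) ℂ) :
    relabel (Orb.translate w) (particleHoleAut (fun i : Orb (FermionTorus 2 L) => torusStagger (ofLex i).1) X) =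
      particleHoleAut (fun i : Orb (FermionTorus 2 L) =>
          torusStagger (FermionTorus.ofTorusSite (-w)) * torusStagger (ofLex i).1)
        (relabel (Orb.translate w) X) := by
  have hfun : (fun i : Orb (FermionTorus 2 L) => torusStagger (ofLex ((Orb.translate w).symm i)).1) =
      fun i => torusStagger (FermionTorus.ofTorusSite (-w)) * torusStagger (ofLex i).1 :=
    funext fun i => torusStagger_translate_symm hL w i
  rw [relabel_particleHoleAut, hfun]

/-- `⟨U_w φ, Y U_w φ⟩ = ⟨φ, Γ(τ_{-w})(Y) φ⟩` (`U_wᴴ = U_{-w}` and `Γ(τ_v) Y = U_v Y U_vᴴ`: the translation unitaries implement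
the shift automorphisms). [cite: BratteliRobinsonII1997, §5.2.2 Thm. 5.2.5] -/
theorem expect_fockTranslate_mulVec_eq_relabel [NeZero L] (w : TorusSite 2 L)
    (Y : Matrix (Finset (Orb (FermionTorus 2 L))) (Finset (Orb (FermionTorus 2 L))) ℂ)
    (φ : Fock (Orb (FermionTorus 2 L))) :
    expect Y ((fockTranslate w).val *ᵥ φ) = expect (relabel (Orb.translate (-w)) Y) φ := by
  have hU : (fockTranslate (-w)).valᴴ = (fockTranslate w).val := by
    rw [fockTranslate_val_conjTranspose, neg_neg]
  rw [expect, expect, star_mulVec, ← dotProduct_mulVec, mulVec_mulVec, mulVec_mulVec, relabel_eq_fockRelabel_conj,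
    fockTranslate_val_conjTranspose]
  change _ = star φ ⬝ᵥ ((fockTranslate (-w)).val * Y * (fockTranslate (-w)).valᴴ) *ᵥ φ
  rw [hU]

/-- **Term by term, the averaged expectation of `α(B)` in `U_w ψ` is that of `B` in `U_w P_Lᴴ ψ`** for every
`N`-particle vector `ψ` of the even torus and every torus matrix `B`: conjugating by the translation changes
the signs of `α` by the global factor `ε_{ι(w)} = ±1`, i.e. by at most one `Θ`, which is invisible in an
`N`-particle vector (`expect_parityAut_of_isNParticle`). [cite: ArakiMoriya2003, §4.1 Def. 4.3 and Def. 4.5] -/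
theorem expect_particleHoleAut_fockTranslate_mulVec [NeZero L] (hL : Even L) (w : TorusSite 2 L)
    (B : Matrix (Finset (Orb (FermionTorus 2 L))) (Finset (Orb (FermionTorus 2 L))) ℂ) {N : ℕ}
    {ψ : Fock (Orb (FermionTorus 2 L))} (hψ : IsNParticle N ψ) :
    expect (particleHoleAut (fun i : Orb (FermionTorus 2 L) => torusStagger (ofLex i).1) B)
        ((fockTranslate w).val *ᵥ ψ) =
      expect B ((fockTranslate w).val *ᵥ
        ((particleHole (fun i : Orb (FermionTorus 2 L) => ((torusStagger (ofLex i).1 : ℤ) : ℂ)))ᴴ *ᵥ ψ)) := by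
  rw [expect_fockTranslate_mulVec_eq_relabel, expect_fockTranslate_mulVec_eq_relabel,
    relabel_translate_particleHoleAut hL, particleHoleAut_units_mul]
  split_ifs with hs
  · rw [expect_particleHoleAut]
  · rw [expect_parityAut_of_isNParticle hψ, expect_particleHoleAut]

/-- **The translation-averaged expectation of `α_Λ(A)` in `ψ` is that of `A` in `P_Lᴴ ψ`** (`L` even, `ψ` an
`N`-particle vector of the torus `(ℤ/Lℤ)²`, `Λ ⊆ ℤ²` any region, `A ∈ 𝔄_Λ`):
`torusAvgExpectAt L Λ (α_Λ A) ψ = torusAvgExpectAt L Λ A (P_Lᴴ ψ)` (pull-back dictionary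
`Γ(ι_{Λ,L})(α_Λ A) = α(Γ(ι_{Λ,L}) A)`, `fermionEmbed_toTorusEmb_phAut`, then term by term).
[cite: Tasaki2020, §9.3.3] [cite: BratteliRobinsonI1987, §4.3.1 (PDF pp. 373–375)] -/
theorem torusAvgExpectAt_phAut_eq [NeZero L] (hL : Even L) (Λ : Finset (Site 2)) (A : FermionOp Λ) {N : ℕ}
    {ψ : Fock (Orb (FermionTorus 2 L))} (hψ : IsNParticle N ψ) :
    torusAvgExpectAt L Λ (phAut Λ A) ψ =
      torusAvgExpectAt L Λ A
        ((particleHole (fun i : Orb (FermionTorus 2 L) => ((torusStagger (ofLex i).1 : ℤ) : ℂ)))ᴴ *ᵥ ψ) := by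
  by_cases h : Set.InjOn (Torus.proj (d := 2) L) ↑Λ
  · rw [torusAvgExpectAt_of_injOn L h, torusAvgExpectAt_of_injOn L h, fermionEmbed_toTorusEmb_phAut hL h]
    refine congrArg (fun z : ℂ => ((Fintype.card (TorusSite 2 L) : ℂ))⁻¹ * z) ?_
    exact Finset.sum_congr rfl fun w _ => expect_particleHoleAut_fockTranslate_mulVec hL w _ hψ
  · rw [torusAvgExpectAt_of_not_injOn L h, torusAvgExpectAt_of_not_injOn L h]

/-- `torusAvgExpectAt_phAut_eq` for an arbitrary side `L` (junk value `0` at `L = 0` on both sides).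
[cite: Tasaki2020, §9.3.3] -/
theorem torusAvgExpect_phAut_eq (hL : Even L) (Λ : Finset (Site 2)) (A : FermionOp Λ) {N : ℕ}
    {ψ : Fock (Orb (FermionTorus 2 L))} (hψ : IsNParticle N ψ) :
    torusAvgExpect L Λ (phAut Λ A) ψ =
      torusAvgExpect L Λ A
        ((particleHole (fun i : Orb (FermionTorus 2 L) => ((torusStagger (ofLex i).1 : ℤ) : ℂ)))ᴴ *ᵥ ψ) := by
  rcases Nat.eq_zero_or_pos L with rfl | hpos
  · rw [torusAvgExpect_zero, torusAvgExpect_zero]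
  · haveI : NeZero L := NeZero.of_pos hpos
    rw [torusAvgExpect_eq, torusAvgExpect_eq, torusAvgExpectAt_phAut_eq hL Λ A hψ]

end Torus

/-! ### §3 Torus limits of `N`-particle families under `α`: `ω ∘ α` is the torus limit of the transformed family -/

namespace InfVolFermionState

/-- Torus limits pass to subsequences (and to any reparametrisation `φ → ∞`). [cite: BratteliRobinsonI1987, §4.3.1 (PDF pp. 373–375)] -/
theorem IsTorusLimitOf.comp_tendsto {d : ℕ} {ω : InfVolFermionState d} {ψ : ∀ L, Fock (Orb (FermionTorus d L))}
    {Ls : ℕ → ℕ} (h : ω.IsTorusLimitOf ψ Ls) {φ : ℕ → ℕ} (hφ : Tendsto φ atTop atTop) :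
    ω.IsTorusLimitOf ψ (Ls ∘ φ) := fun Λ A => (h Λ A).comp hφ

/-- Torus limits along `Ls` only read the family at the sides `Ls j`, eventually: two families that agree at
`Ls j` for all large `j` have the same torus limits along `Ls` (weak-⋆ limits of the averaged torus states only depend on the
tail of the sequence). [cite: BratteliRobinsonI1987, §4.3.1 (PDF pp. 373–375)] -/
theorem IsTorusLimitOf.congr_family {d : ℕ} {ω : InfVolFermionState d} {ψ ψ' : ∀ L, Fock (Orb (FermionTorus d L))}
    {Ls : ℕ → ℕ} (h : ω.IsTorusLimitOf ψ Ls) (hψ : ∀ᶠ j in atTop, ψ (Ls j) = ψ' (Ls j)) :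
    ω.IsTorusLimitOf ψ' Ls := fun Λ A =>
  (h Λ A).congr' (hψ.mono fun j hj => by rw [hj])

/-- **The particle–hole transform of a torus limit of `N`-particle vectors is the torus limit of the transformed
vectors** (two dimensions, eventually-even sides): if `ω` is the torus limit of the `N_j`-particle vectors `ψ (Ls j)`
along `Ls` with `Ls j` eventually even, then `ω ∘ α` is the torus limit along `Ls` of the family `P_Lᴴ ψ_L`
(`P_L` = the staggered particle–hole unitary of the torus of side `L`).
[cite: Tasaki2020, §9.3.3] [cite: BratteliRobinsonI1987, §4.3.1 (PDF pp. 373–375)] -/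
theorem IsTorusLimitOf.particleHole {ω : InfVolFermionState 2} {ψ : ∀ L, Fock (Orb (FermionTorus 2 L))}
    {Ls : ℕ → ℕ} (h : ω.IsTorusLimitOf ψ Ls) {N : ℕ → ℕ} (hN : ∀ j, IsNParticle (N j) (ψ (Ls j)))
    (heven : ∀ᶠ j in atTop, Even (Ls j)) :
    ω.particleHole.IsTorusLimitOf
      (fun L => (QuantumLattice.particleHole (fun i : Orb (FermionTorus 2 L) => ((torusStagger (ofLex i).1 : ℤ) : ℂ)))ᴴ *ᵥ ψ L)
      Ls := by
  intro Λ A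
  rw [particleHole_expect]
  refine (h Λ (phAut Λ A)).congr' ?_
  filter_upwards [heven] with j hev
  exact torusAvgExpect_phAut_eq hev Λ A (hN j)

end InfVolFermionState

/-! ### §4 The one-body dictionary of `ω ∘ α` (any dimension, any state): hopping words -/

namespace InfVolFermionState

variable {d : ℕ} (ω : InfVolFermionState d)

/-- Distinct labelled orbitals of a region are distinct elements of `Orb (PolySite Λ)`. [folklore] -/
private theorem orb_pt_ne {Λ : Finset (Site d)} {x y : Site d} (hx : x ∈ Λ) (hy : y ∈ Λ) {σ τ : Fin 2}
    (hne : x ≠ y ∨ σ ≠ τ) : orb (PolySite.pt x hx) σ ≠ orb (PolySite.pt y hy) τ := by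
  intro h
  obtain ⟨h1, h2⟩ := orb_eq_orb_iff.1 h
  have h3 : x = y := by
    have := congrArg (fun p : PolySite Λ => ofLex p.1) h1
    simpa using this
  rcases hne with h | h
  · exact h h3
  · exact h h2

/-- **Hopping words under the particle–hole transform**: for distinct orbitals `(x, σ) ≠ (y, τ)` of a region `Λ`,
`(ω ∘ α)(c†_{xσ} c_{yτ}) = -ε_x ε_y · ω(c†_{yτ} c_{xσ})` (`α(c†_{xσ}) = ε_x c_{xσ}`, `α(c_{yτ}) = ε_y c†_{yτ}` and the
CAR). [cite: EsslerEtAl2005, §2.2.4 eqs. (2.59)–(2.61)] -/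
theorem particleHole_expect_cAt_conjTranspose_mul_cAt {Λ : Finset (Site d)} {x y : Site d} (hx : x ∈ Λ)
    (hy : y ∈ Λ) {σ τ : Fin 2} (hne : x ≠ y ∨ σ ≠ τ) :
    ω.particleHole.expect Λ ((cAt x hx σ)ᴴ * cAt y hy τ) =
      -((((siteStagger x : ℤˣ) : ℤ) : ℂ) * (((siteStagger y : ℤˣ) : ℤ) : ℂ) *
        ω.expect Λ ((cAt y hy τ)ᴴ * cAt x hx σ)) := by
  have hCAR : cAt x hx σ * (cAt y hy τ)ᴴ = -((cAt y hy τ)ᴴ * cAt x hx σ) := by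
    have h := annihilation_mul_creation_add_creation_mul_annihilation_holds (orb (PolySite.pt x hx) σ)
      (orb (PolySite.pt y hy) τ)
    rw [if_neg (orb_pt_ne hx hy hne)] at h
    rw [cAt, cAt, annihilation_conjTranspose]
    exact eq_neg_of_add_eq_zero_left h
  rw [particleHole_expect, map_mul, phAut_cAt_conjTranspose, phAut_cAt, Matrix.smul_mul, Matrix.mul_smul, smul_smul,
    hCAR, smul_neg, map_neg, map_smul, smul_eq_mul]

/-- **Bonds joining the two sublattices** (`ε_y = -ε_x`, e.g. nearest neighbours of `ℤ^d`): the hopping word is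
transposed, `(ω ∘ α)(c†_{xσ} c_{yτ}) = ω(c†_{yτ} c_{xσ})`. [cite: EsslerEtAl2005, §2.2.4 eqs. (2.59)–(2.61)] -/
theorem particleHole_expect_cAt_conjTranspose_mul_cAt_of_siteStagger_eq_neg {Λ : Finset (Site d)} {x y : Site d}
    (hx : x ∈ Λ) (hy : y ∈ Λ) (σ τ : Fin 2) (h : siteStagger y = -siteStagger x) :
    ω.particleHole.expect Λ ((cAt x hx σ)ᴴ * cAt y hy τ) = ω.expect Λ ((cAt y hy τ)ᴴ * cAt x hx σ) := by
  have hne : x ≠ y ∨ σ ≠ τ := by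
    refine Or.inl fun hxy => ?_
    subst hxy
    rcases siteStagger_eq_one_or x with h1 | h1 <;> rw [h1] at h <;> exact absurd h (by decide)
  have hprod : (((siteStagger x : ℤˣ) : ℤ) : ℂ) * (((siteStagger y : ℤˣ) : ℤ) : ℂ) = -1 := by
    rw [h, Units.val_neg, Int.cast_neg, mul_neg, ← Int.cast_mul, ← Units.val_mul, Int.units_mul_self, Units.val_one,
      Int.cast_one]
  rw [particleHole_expect_cAt_conjTranspose_mul_cAt ω hx hy hne, hprod, neg_one_mul, neg_neg]

/-- **Bonds inside one sublattice** (`ε_y = ε_x`, e.g. next-nearest (diagonal) neighbours of `ℤ²`; distinct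
orbitals): the hopping word is transposed AND changes sign, `(ω ∘ α)(c†_{xσ} c_{yτ}) = -ω(c†_{yτ} c_{xσ})` — the
`t' ↦ -t'` of the reflected model. [cite: EsslerEtAl2005, §2.2.4 eqs. (2.59)–(2.61)] -/
theorem particleHole_expect_cAt_conjTranspose_mul_cAt_of_siteStagger_eq {Λ : Finset (Site d)} {x y : Site d}
    (hx : x ∈ Λ) (hy : y ∈ Λ) {σ τ : Fin 2} (hne : x ≠ y ∨ σ ≠ τ) (h : siteStagger y = siteStagger x) :
    ω.particleHole.expect Λ ((cAt x hx σ)ᴴ * cAt y hy τ) = -ω.expect Λ ((cAt y hy τ)ᴴ * cAt x hx σ) := by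
  have hprod : (((siteStagger x : ℤˣ) : ℤ) : ℂ) * (((siteStagger y : ℤˣ) : ℤ) : ℂ) = 1 := by
    rw [h, ← Int.cast_mul, ← Units.val_mul, Int.units_mul_self, Units.val_one, Int.cast_one]
  rw [particleHole_expect_cAt_conjTranspose_mul_cAt ω hx hy hne, hprod, one_mul]

/-- **The kinetic bond word is particle–hole invariant on sublattice-joining bonds**:
`(ω ∘ α)(c†_{xσ} c_{yτ} + c†_{yτ} c_{xσ}) = ω(c†_{xσ} c_{yτ} + c†_{yτ} c_{xσ})` whenever `ε_y = -ε_x` (nearest-neighbour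
kinetic energy, current-free part). [cite: EsslerEtAl2005, §2.2.4 eqs. (2.59)–(2.61)] -/
theorem particleHole_expect_hopping_add_of_siteStagger_eq_neg {Λ : Finset (Site d)} {x y : Site d} (hx : x ∈ Λ)
    (hy : y ∈ Λ) (σ τ : Fin 2) (h : siteStagger y = -siteStagger x) :
    ω.particleHole.expect Λ ((cAt x hx σ)ᴴ * cAt y hy τ + (cAt y hy τ)ᴴ * cAt x hx σ) =
      ω.expect Λ ((cAt x hx σ)ᴴ * cAt y hy τ + (cAt y hy τ)ᴴ * cAt x hx σ) := by
  have h' : siteStagger x = -siteStagger y := by rw [h, neg_neg]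
  rw [map_add, map_add, particleHole_expect_cAt_conjTranspose_mul_cAt_of_siteStagger_eq_neg ω hx hy σ τ h,
    particleHole_expect_cAt_conjTranspose_mul_cAt_of_siteStagger_eq_neg ω hy hx τ σ h', add_comm]

/-- **The diagonal (same-sublattice) bond word changes sign**:
`(ω ∘ α)(c†_{xσ} c_{yτ} + c†_{yτ} c_{xσ}) = -ω(c†_{xσ} c_{yτ} + c†_{yτ} c_{xσ})` whenever `ε_y = ε_x` and the orbitals
are distinct (next-nearest-neighbour kinetic energy: `t' ↦ -t'`). [cite: EsslerEtAl2005, §2.2.4 eqs. (2.59)–(2.61)] -/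
theorem particleHole_expect_hopping_add_of_siteStagger_eq {Λ : Finset (Site d)} {x y : Site d} (hx : x ∈ Λ)
    (hy : y ∈ Λ) {σ τ : Fin 2} (hne : x ≠ y ∨ σ ≠ τ) (h : siteStagger y = siteStagger x) :
    ω.particleHole.expect Λ ((cAt x hx σ)ᴴ * cAt y hy τ + (cAt y hy τ)ᴴ * cAt x hx σ) =
      -ω.expect Λ ((cAt x hx σ)ᴴ * cAt y hy τ + (cAt y hy τ)ᴴ * cAt x hx σ) := by
  have hne' : y ≠ x ∨ τ ≠ σ := hne.imp Ne.symm Ne.symm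
  rw [map_add, map_add, particleHole_expect_cAt_conjTranspose_mul_cAt_of_siteStagger_eq ω hx hy hne h,
    particleHole_expect_cAt_conjTranspose_mul_cAt_of_siteStagger_eq ω hy hx hne' h.symm, neg_add, add_comm]

end InfVolFermionState

end Literature.MathematicalPhysics.QuantumLattice
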